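import Summits.Langlands.Langlands.Theses.PicardMuOrdinary
import Summits.Langlands.Langlands.Theorems.MuOrdinaryFamilyRT.Negative.SepRedundant
import Literature.AlgebraicGeometry.Motives.PicardCurveMuOrdinaryReduction

/-!
# `MuOrdinaryFamilyRT`: the μ-ordinary scope predicate is empty over `ℚ` — formal consequences

Negative-side lemmas of the standing disprover of the crux
`Summit.Langlands.Langlands.Theses.PicardMuOrdinary.MuOrdinaryFamilyRT` (item stmt-Langlands-13757),
cycle 3.  The crux lines `weight-blind-lambda-adic-rt` and `definite-trianguline-fern` (and the four
round-1 idea cards of ideators k2, k3) place their engines on the scope predicate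
`Literature.AlgebraicGeometry.Motives.HasMuOrdinaryReductionAtThree f`: a smooth proper model of the
CURVE `y³ = f(x)` over `𝓞_{M,w}`, `M ∋ ω`, `w ∣ 3`, whose special fibre has `3`-rank `2`.

PAPER FACT (not provable in the tree, taken below as the explicit hypothesis `hBBW`): for every
separable quartic `f ∈ ℤ[X]` this predicate is FALSE.  Börner–Bouw–Wewers, *Picard curves with small
conductor* (2017, arXiv:1701.01986, doi:10.1007/978-3-319-70566-8_4), §3.2, the Lemma with the genus
table `g(W) | r | h | g(W/Γ⁰)`: over an absolutely unramified `3`-adic field (e.g. `ℚ₃^{nr}`, so for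
every Picard curve over `ℚ`) an étale genus-`3` component of the stable fibre is branched over ONE
point with lower jump `4` — the two-branch-point case "does not occur" (an inertia element `τ` with
`τ(ζ₃) = ζ₃²` of 2-power order `m` would fix both ramification points, and Pries' centraliser formula
gives `gcd(1, m) ≠ gcd(2, m)`).  Hence a potentially good Picard curve over `ℚ` reduces to
`y³ − y = x⁴`, of `3`-rank `0` (Deuring–Šafarevič), whereas a smooth proper model over `𝓞_{M,w}` has the
stable fibre as special fibre and any `FrobeniusEigenvalues` presentation of its point counts is the
true eigenvalue multiset, with no unit root above `3`.

FORMAL TOOTH proved here (sorry-free, no hypothesis): `not_hasSimpleUnitRoots_two` — a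
`FrobeniusEigenvalues` presentation with `p ∣ q + 1 − N₁`, `p ∣ q² + 1 − N₂` (`p` odd, `p ∈ 𝔓`) has
`#unitRoots 𝔓 ≠ 2` (`u₁ + u₂, u₁² + u₂² ∈ 𝔓 ⇒ 2 u₁ u₂ ∈ 𝔓`); hence a witness
`W : MuOrdinaryModelAtThree f M` cannot have a special fibre with `N₁ ≡ q + 1`, `N₂ ≡ q² + 1 (mod 3)`
(`not_supersingularLike_witness`; `ringChar k(w) = 3` from `three_mem`), and
`not_hasMuOrdinaryReductionAtThree_of_supersingularLike` reduces `¬ HasMuOrdinaryReductionAtThree f`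
to BBW's fibre statement (every smooth proper model at `w ∣ 3` has supersingular-looking first two
counts — true for every form of `y³ − y = x⁴`, e.g. `N₁ = 4, N₂ = 10` over `𝔽₃`,
`not_hasSimpleUnitRoots_two_fermatAS`).

CONSEQUENCES proved here, sorry-free, each with the blunt `hBBW` as hypothesis:
* `not_hasMuOrdinaryReductionAtThree_of_generic` — for generic `f` (`deg 4`, `12 ∣ #Gal`;
  separability is automatic, `separable_of_twelve_dvd_card_gal`) the in-scope hypothesis of the
  lines' engine stubs is never satisfied;
* `weightBlind_remainder_hyp` — the hypothesis of `stub_remainder` of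
  `Cruxes/MuOrdinaryFamilyRT/Lines/weight-blind-lambda-adic-rt.lean` holds for every generic `f`;
* `muOrdinaryFamilyRT_iff_remainder` — the crux is EQUIVALENT to its restriction to
  `¬ HasMuOrdinaryReductionAtThree f` (the fern line's `stub_supersingularRemainder`): the conceded
  remainder stub of those lines is the whole crux.
The correct scope is Galois-side ("`ρ_C|Γ_{K_λ}` upper-triangular", `PicardBorelAt3` of the free-seed
line; Jacobian-level: BBW types (b), (d), (e)), which is non-empty: `3x⁴ + x³ − 54` (`S₄`; BBW §3.3,
type (b), tame, `f₃ = 4`).  See `Cruxes/MuOrdinaryFamilyRT/Disproof.lean`, F12.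
-/

set_option linter.dupNamespace false -- project-wide option (lakefile weak.linter.dupNamespace); `Summit.Langlands.Langlands` is the mandated namespace

namespace Summit.Langlands.Langlands.Theorems.MuOrdinaryFamilyRT.Negative

open Polynomial Literature.AlgebraicGeometry.Motives
open Summit.Langlands.Langlands.Theses.PicardMuOrdinary
open IsDedekindDomain
open scoped NumberField

/-! ### The formal tooth: the `3`-rank-`2` clause versus supersingular-looking point counts -/

section Tooth

variable {q : ℕ} {N : ℕ → ℕ} {F : Type*} [Field F] [NumberField F]

/-- The power sums of a Frobenius-eigenvalue presentation are the integers `q^m + 1 − N m`. [folklore] -/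
theorem powerSum_eq_intCast (E : FrobeniusEigenvalues q N F) {m : ℕ} (hm : 0 < m) :
    (E.α.map (· ^ m)).sum = (((q : ℤ) ^ m + 1 - (N m : ℤ) : ℤ) : 𝓞 F) := by
  have h := E.count_eq m hm
  push_cast
  linear_combination h

/-- If `p ∣ q^m + 1 − N m` and `p ∈ 𝔓` then the `m`-th power sum lies in `𝔓`. [folklore] -/
theorem powerSum_mem (E : FrobeniusEigenvalues q N F) {p : ℕ}
    (𝔓 : HeightOneSpectrum (𝓞 F)) (hp𝔓 : (p : 𝓞 F) ∈ 𝔓.asIdeal) {m : ℕ} (hm : 0 < m)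
    (hdvd : (p : ℤ) ∣ (q : ℤ) ^ m + 1 - N m) :
    (E.α.map (· ^ m)).sum ∈ 𝔓.asIdeal := by
  obtain ⟨c, hc⟩ := hdvd
  rw [powerSum_eq_intCast E hm, hc]
  push_cast
  exact Ideal.mul_mem_right _ _ hp𝔓

/-- Splitting off the unit roots: `α = unitRoots + rest` with every element of `rest` in `𝔓`.
[folklore] -/
theorem exists_add_of_unitRoots (E : FrobeniusEigenvalues q N F)
    (𝔓 : HeightOneSpectrum (𝓞 F)) :
    ∃ rest : Multiset (𝓞 F), E.α = E.unitRoots 𝔓 + rest ∧ ∀ b ∈ rest, b ∈ 𝔓.asIdeal := by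
  classical
  obtain ⟨rest, hrest⟩ := Multiset.le_iff_exists_add.mp (E.unitRoots_le 𝔓)
  refine ⟨rest, hrest, fun b hb => ?_⟩
  by_contra hb𝔓
  have hcount : Multiset.count b (E.unitRoots 𝔓) = Multiset.count b E.α := by
    unfold FrobeniusEigenvalues.unitRoots
    convert Multiset.count_filter_of_pos (p := fun a => a ∉ 𝔓.asIdeal) (s := E.α) hb𝔓
  have hsum : Multiset.count b E.α = Multiset.count b (E.unitRoots 𝔓) + Multiset.count b rest := by
    conv_lhs => rw [hrest]
    exact Multiset.count_add b _ _
  have h0 : Multiset.count b rest = 0 := by omega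
  exact (Multiset.count_eq_zero.mp h0) hb

/-- **Two simple unit roots are incompatible with `p`-divisible first and second power sums** (`p` odd,
`p ∈ 𝔓`): from `u₁ + u₂ ∈ 𝔓` and `u₁² + u₂² ∈ 𝔓` one gets `2 u₁ u₂ ∈ 𝔓`, so a "unit" lies in `𝔓`.
(The `Nodup` clause of `HasSimpleUnitRoots` is not even used.) [folklore] -/
theorem card_unitRoots_ne_two (E : FrobeniusEigenvalues q N F) {p : ℕ} (hp : Odd p)
    (𝔓 : HeightOneSpectrum (𝓞 F)) (hp𝔓 : (p : 𝓞 F) ∈ 𝔓.asIdeal)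
    (h1 : (p : ℤ) ∣ (q : ℤ) + 1 - N 1) (h2 : (p : ℤ) ∣ (q : ℤ) ^ 2 + 1 - N 2) :
    Multiset.card (E.unitRoots 𝔓) ≠ 2 := by
  classical
  intro hcard
  obtain ⟨u₁, u₂, hu⟩ := Multiset.card_eq_two.mp hcard
  have hprime : 𝔓.asIdeal.IsPrime := 𝔓.isPrime
  obtain ⟨rest, hsplit, hrest⟩ := exists_add_of_unitRoots E 𝔓
  -- the rest contributes elements of 𝔓 to every power sum
  have hrestsum : ∀ m, 0 < m → (rest.map (· ^ m)).sum ∈ 𝔓.asIdeal := by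
    intro m hm
    refine Multiset.sum_induction _ _ (fun a b ha hb => Ideal.add_mem _ ha hb) (Ideal.zero_mem _) ?_
    intro x hx
    obtain ⟨b, hb, rfl⟩ := Multiset.mem_map.mp hx
    exact Ideal.pow_mem_of_mem _ (hrest b hb) m hm
  -- hence u₁^m + u₂^m ∈ 𝔓 for m = 1, 2
  have hunits : ∀ m, 0 < m → (p : ℤ) ∣ (q : ℤ) ^ m + 1 - N m → u₁ ^ m + u₂ ^ m ∈ 𝔓.asIdeal := by
    intro m hm hdvd
    have h := powerSum_mem E 𝔓 hp𝔓 hm hdvd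
    rw [hsplit, hu, Multiset.map_add, Multiset.sum_add] at h
    have h' := Ideal.sub_mem _ h (hrestsum m hm)
    simpa using h'
  have e1 : u₁ + u₂ ∈ 𝔓.asIdeal := by simpa using hunits 1 one_pos (by simpa using h1)
  have e2 : u₁ ^ 2 + u₂ ^ 2 ∈ 𝔓.asIdeal := hunits 2 two_pos h2
  have h2u : 2 * (u₁ * u₂) ∈ 𝔓.asIdeal := by
    have : 2 * (u₁ * u₂) = (u₁ + u₂) ^ 2 - (u₁ ^ 2 + u₂ ^ 2) := by ring
    rw [this]
    exact Ideal.sub_mem _ (Ideal.pow_mem_of_mem _ e1 2 two_pos) e2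
  have h2not : (2 : 𝓞 F) ∉ 𝔓.asIdeal := by
    intro h2mem
    obtain ⟨k, hk⟩ := hp
    apply hprime.ne_top
    rw [Ideal.eq_top_iff_one]
    have : (1 : 𝓞 F) = (p : 𝓞 F) - 2 * (k : 𝓞 F) := by rw [hk]; push_cast; ring
    rw [this]
    exact Ideal.sub_mem _ hp𝔓 (Ideal.mul_mem_right _ _ h2mem)
  have hu1 : u₁ ∈ E.unitRoots 𝔓 := by rw [hu]; simp
  have hu2 : u₂ ∈ E.unitRoots 𝔓 := by rw [hu]; simp
  rw [FrobeniusEigenvalues.mem_unitRoots] at hu1 hu2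
  rcases hprime.mem_or_mem h2u with h | h
  · exact h2not h
  · rcases hprime.mem_or_mem h with h | h
    · exact hu1.2 h
    · exact hu2.2 h

/-- **No `3`-rank-`2` presentation with supersingular-looking counts.**  If `p` is odd and the point
counts satisfy `N 1 ≡ q + 1` and `N 2 ≡ q² + 1 (mod p)` — as they do for every curve over `𝔽_q`,
`q = pᵃ`, whose Jacobian has `p`-rank `0` (all Frobenius eigenvalues have positive valuation above
`p`, so every power sum is `≡ 0 mod p`), in particular for every `𝔽_q`-form of `y³ − y = x⁴` — then
`HasSimpleUnitRoots p q N 2` is false.  This is the arithmetic content of the last clause of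
`MuOrdinaryModelAtThree`; with Börner–Bouw–Wewers 2017 §3.2 (the special fibre of any smooth model of a
Picard curve over `ℚ` at a place above `3` is a form of `y³ − y = x⁴`) it gives
`¬ HasMuOrdinaryReductionAtThree f`. [folklore] -/
theorem not_hasSimpleUnitRoots_two {p q : ℕ} (hp : Odd p) {N : ℕ → ℕ}
    (h1 : (p : ℤ) ∣ (q : ℤ) + 1 - N 1) (h2 : (p : ℤ) ∣ (q : ℤ) ^ 2 + 1 - N 2) :
    ¬ HasSimpleUnitRoots p q N 2 := by
  rintro ⟨F, _, _, E, 𝔓, hp𝔓, hcard, -⟩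
  exact card_unitRoots_ne_two E hp 𝔓 hp𝔓 h1 h2 hcard

/-- The point counts of `y³ − y = x⁴` over `𝔽₃`: `N₁ = 4`, `N₂ = 10` (`L(T) = (1 − 3T²)²(1 + 3T²)`,
kit j007450; power sums `0` and `6`), so `3 ∣ 3 + 1 − 4` and `3 ∣ 9 + 1 − 10`: no `3`-rank-`2`
presentation of THESE counts exists, whatever `N m` is for `m ≥ 3`. [folklore] -/
theorem not_hasSimpleUnitRoots_two_fermatAS {N : ℕ → ℕ} (hN1 : N 1 = 4) (hN2 : N 2 = 10) :
    ¬ HasSimpleUnitRoots 3 3 N 2 :=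
  not_hasSimpleUnitRoots_two (by decide) (by rw [hN1]; decide) (by rw [hN2]; decide)


/-! ### At the level of the witness structure `MuOrdinaryModelAtThree` -/

section Witness

variable {f : Polynomial ℤ} {M : Type} [Field M] [NumberField M]

/-- The residue field of the place `w ∣ 3` of a witness has characteristic `3`. [folklore] -/
theorem ringChar_residueField_witness (W : MuOrdinaryModelAtThree f M) :
    ringChar W.w.asIdeal.ResidueField = 3 := by
  have h : algebraMap (𝓞 M) W.w.asIdeal.ResidueField 3 = 0 :=
    Ideal.algebraMap_residueField_eq_zero.mpr W.three_mem
  rw [map_ofNat] at h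
  apply CharP.ringChar_of_prime_eq_zero Nat.prime_three
  rw [Nat.cast_ofNat]
  exact h

/-- **A witness's special fibre does NOT have supersingular-looking point counts**: if
`W : MuOrdinaryModelAtThree f M` then it is false that `N₁ ≡ q + 1` and `N₂ ≡ q² + 1 (mod 3)` for the
special fibre `W.model.reductionAt` over `k(w) = 𝔽_q`.  (Contrapositive of the `3`-rank-`2` clause,
by `not_hasSimpleUnitRoots_two`.) [folklore] -/
theorem not_supersingularLike_witness (W : MuOrdinaryModelAtThree f M) :
    ¬ ((3 : ℤ) ∣ (Nat.card W.w.asIdeal.ResidueField : ℤ) + 1 - pointCount W.model.reductionAt 1 ∧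
       (3 : ℤ) ∣ (Nat.card W.w.asIdeal.ResidueField : ℤ) ^ 2 + 1 - pointCount W.model.reductionAt 2) := by
  rintro ⟨h1, h2⟩
  have h := W.hasSimpleUnitRoots
  unfold SchemeOver.HasSimpleUnitRoots at h
  rw [ringChar_residueField_witness W] at h
  exact not_hasSimpleUnitRoots_two (by decide) h1 h2 h

/-- **Formal reduction of the scope vacuity to BBW's special-fibre statement.**  If for every number
field `M ∋ ω`, place `w ∣ 3` and smooth proper model of the Picard curve `y³ = f(x)` over `𝓞_{M,w}`
(packaged, together with the clause to be refuted, as `W : MuOrdinaryModelAtThree f M`) the special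
fibre has supersingular-looking counts `N₁ ≡ q + 1`, `N₂ ≡ q² + 1 (mod 3)` — which is what
Börner–Bouw–Wewers 2017 §3.2 gives for Picard curves over `ℚ` (the fibre is a form of `y³ − y = x⁴`,
`3`-rank `0`, all Frobenius eigenvalues of positive `3`-adic valuation) — then
`¬ HasMuOrdinaryReductionAtThree f`. [folklore] -/
theorem not_hasMuOrdinaryReductionAtThree_of_supersingularLike (f : Polynomial ℤ)
    (hBBW : ∀ (M : Type) [Field M] [NumberField M] (W : MuOrdinaryModelAtThree f M),
      (3 : ℤ) ∣ (Nat.card W.w.asIdeal.ResidueField : ℤ) + 1 - pointCount W.model.reductionAt 1 ∧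
      (3 : ℤ) ∣ (Nat.card W.w.asIdeal.ResidueField : ℤ) ^ 2 + 1 - pointCount W.model.reductionAt 2) :
    ¬ HasMuOrdinaryReductionAtThree f := by
  rintro ⟨M, _, _, ⟨W⟩⟩
  exact not_supersingularLike_witness W (hBBW M W)

end Witness

end Tooth


/-- **Modulo BBW, no generic `f` is in scope**: if no separable quartic has μ-ordinary potentially
good reduction at `3` (Börner–Bouw–Wewers 2017, §3.2), then for `f` of degree `4` with `12 ∣ #Gal`
(separable by `separable_of_twelve_dvd_card_gal`) `¬ HasMuOrdinaryReductionAtThree f`. [folklore] -/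
theorem not_hasMuOrdinaryReductionAtThree_of_generic
    (hBBW : ∀ f : ℤ[X], f.natDegree = 4 → (f.map (Int.castRingHom ℚ)).Separable →
      ¬ HasMuOrdinaryReductionAtThree f)
    (f : ℤ[X]) (hdeg : f.natDegree = 4) (hgal : 12 ∣ Nat.card (f.map (Int.castRingHom ℚ)).Gal) :
    ¬ HasMuOrdinaryReductionAtThree f :=
  hBBW f hdeg (separable_of_twelve_dvd_card_gal f hdeg hgal)

/-- **Modulo BBW, weight-blind's remainder hypothesis always holds**:
`¬ (HasMuOrdinaryReductionAtThree f ∧ ¬ IsSquare disc ∧ ¬ IsSquare (−3·disc))` for every generic `f`,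
so `MuOrdinaryFamilyRT_of` of that line routes every curve into `stub_remainder`. [folklore] -/
theorem weightBlind_remainder_hyp
    (hBBW : ∀ f : ℤ[X], f.natDegree = 4 → (f.map (Int.castRingHom ℚ)).Separable →
      ¬ HasMuOrdinaryReductionAtThree f)
    (f : ℤ[X]) (hdeg : f.natDegree = 4) (hgal : 12 ∣ Nat.card (f.map (Int.castRingHom ℚ)).Gal) :
    ¬ (HasMuOrdinaryReductionAtThree f ∧ ¬ IsSquare (f.map (Int.castRingHom ℚ)).discr ∧
        ¬ IsSquare ((-3 : ℚ) * (f.map (Int.castRingHom ℚ)).discr)) :=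
  fun h => not_hasMuOrdinaryReductionAtThree_of_generic hBBW f hdeg hgal h.1

section Remainder

open scoped BigOperators Topology Manifold Classical MeasureTheory ProbabilityTheory Matrix InnerProductSpace ComplexConjugate ContinuousMap
open Filter Set Function TopologicalSpace MeasureTheory

/-- **Modulo BBW, the crux is equivalent to its "supersingular remainder"** — the crux with the
extra hypothesis `¬ HasMuOrdinaryReductionAtThree f` (body otherwise verbatim; this is
`stub_supersingularRemainder` of `Lines/definite-trianguline-fern.lean` unfolded).  So the stub those
lines concede and do not attack is, as typed, the whole crux. [folklore] -/
theorem muOrdinaryFamilyRT_iff_remainder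
    (hBBW : ∀ f : ℤ[X], f.natDegree = 4 → (f.map (Int.castRingHom ℚ)).Separable →
      ¬ HasMuOrdinaryReductionAtThree f) :
    MuOrdinaryFamilyRT ↔
      ∀ (f : Polynomial ℤ)
        (hcpt : Literature.NumberTheory.Automorphic.isCompact_glFiniteIntegralLevel 3
          (CyclotomicField 3 ℚ)),
        f.natDegree = 4 → (f.map (Int.castRingHom ℚ)).Separable →
          12 ∣ Nat.card (f.map (Int.castRingHom ℚ)).Gal → ¬ HasMuOrdinaryReductionAtThree f →
          (∃ (P : Literature.NumberTheory.Automorphic.CuspidalAutomorphicRepData 3 (CyclotomicField 3 ℚ) hcpt) (𝔐 : Ideal (integralClosure ℤ ℂ)), P.1.IsRegularAlgebraic ∧ 𝔐.IsMaximal ∧ (3 : (integralClosure ℤ ℂ)) ∈ 𝔐 ∧ ∀ᶠ 𝔭 : IsDedekindDomain.HeightOneSpectrum (NumberField.RingOfIntegers (CyclotomicField 3 ℚ)) in Filter.cofinite, ∃ (α : Multiset ℂ) (Q : Polynomial (integralClosure ℤ ℂ)), P.1.HasSatakeParamAt 𝔭 α ∧ Q.map (algebraMap (integralClosure ℤ ℂ)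 ℂ) = (α.map (fun a => Polynomial.X - Polynomial.C ((𝔭.residueCard : ℂ) * a))).prod ∧ Q.map (Ideal.Quotient.mk 𝔐) = (if (f.map ((Ideal.Quotient.mk 𝔭.asIdeal).comp (algebraMap ℤ (NumberField.RingOfIntegers (CyclotomicField 3 ℚ))))).roots.toFinset.card = 4 then (Polynomial.X - 1) ^ 3 else if (f.map ((Ideal.Quotient.mk 𝔭.asIdeal).comp (algebraMap ℤ (NumberField.RingOfIntegers (CyclotomicField 3 ℚ))))).roots.toFinset.card = 2 then (Polynomial.X - 1) ^ 2 * (Polynomial.X + 1) else if (f.map ((Ideal.Quotient.mk 𝔭.asIdeal).comp (algebraMap ℤ (NumberField.RingOfIntegers (CyclotomicField 3 ℚ))))).roots.toFinset.card = 1 then Polynomial.X ^ 3 - 1 else if (∃ y : ((NumberField.RingOfIntegers (CyclotomicField 3 ℚ)) ⧸ 𝔭.asIdeal), y ^ 2 = (f.map ((Ideal.Quotient.mk 𝔭.asIdeal).comp (algebraMap ℤ (NumberField.RingOfIntegers (CyclotomicField 3 ℚ))))).discr) then (Polynomial.X - 1) * (Polynomial.X + 1) ^ 2 else Polynomial.X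 ^ 3 + Polynomial.X ^ 2 + Polynomial.X + 1 : Polynomial ℤ).map (Int.castRingHom ((integralClosure ℤ ℂ) ⧸ 𝔐))) →
          ∃ (e : CyclotomicField 3 ℚ →+* ℂ) (𝔐 : Ideal (integralClosure ℤ ℂ)) (S : Finset (IsDedekindDomain.HeightOneSpectrum (NumberField.RingOfIntegers (CyclotomicField 3 ℚ)))), 𝔐.IsMaximal ∧ (3 : (integralClosure ℤ ℂ)) ∈ 𝔐 ∧ ∀ k : ℕ, ∃ P : Literature.NumberTheory.Automorphic.CuspidalAutomorphicRepData 3 (CyclotomicField 3 ℚ) hcpt, P.1.IsRegularAlgebraic ∧ ∀ 𝔭 ∉ S, ∃ (α : Multiset ℂ) (t u : (integralClosure ℤ ℂ)), P.1.HasSatakeParamAt 𝔭 α ∧ (t : ℂ) = (𝔭.residueCard : ℂ) * α.sum - e (Literature.NumberTheory.GaloisRepresentations.picardTrace f 𝔭) ∧ u ∉ 𝔐 ∧ u * t ∈ Ideal.span {(3 : (integralClosure ℤ ℂ)) ^ k} :=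
  ⟨fun h f hcpt hdeg hsep hgal _ hres => h f hcpt hdeg hsep hgal hres,
    fun h f hcpt hdeg hsep hgal hres => h f hcpt hdeg hsep hgal (hBBW f hdeg hsep) hres⟩

end Remainder

end Summit.Langlands.Langlands.Theorems.MuOrdinaryFamilyRT.Negative
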